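import Mathlib
import HarnessLib
import Summits.HubbardSuperconductivity.HubbardSuperconductivity.Theorems.KLProgrammeKLRegimeEngineScaleZeroNormsL1

/-!
# K3 engine child (stmt-HubbardSuperconductivity-19855), stub `stub_engine_scale0`, clause (E1-v4)₀: the smallness `θ ≤ 1/2` of the
# scale-`0` determinant-bounded step in closed form

Cell gate-hubbard-kl, seat hubbard-kl-k3c2-p1.  The hypothesis `θ ≤ 1/2` of `klAnisoLegKernelNorm_zero_le_order`
(`θ = e·α·‖Ṽ‖_h/κ₀²` at `α = 4M·A₀/β`, `κ = ρ = κ₀ = √(2·6054)`, profile `h(1) = (β/4M)·kK`, `h(2) = |U|β/(4M)`) in closed form: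
`θ = e·A₀·(4e⁴·kK + 16e⁸κ₀²·|U|)` (**`theta_scaleZero_eq`**) — the `β/M` cancels — hence `θ ≤ 1/2` as soon as
`16e⁵·A₀·kK ≤ 1` and `64e⁹κ₀²·A₀·|U| ≤ 1` (**`theta_scaleZero_le_half`**): the two regime conditions the package thresholds
`U₀`, `c₃` of the engine must deliver (with `kK ≲ Gfr0|U| + Gfr1U² + Gfr2U²(nScales β + 1)`, `sum_norm_framePosKernel_le_of_frameOK`).

Everything is proved; no definitions, no named facts, no sorry.
-/

noncomputable section

namespace Summit.HubbardSuperconductivity.HubbardSuperconductivity.Theorems.EngineV8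

set_option linter.dupNamespace false -- summit = problem name (single-conjunct summit), D-0017

open Real Finset Literature.MathematicalPhysics.QuantumLattice Literature.Probability.LatticeModels
open Literature.MathematicalPhysics.QuantumLattice.GrassmannAlgebra
open Summit.HubbardSuperconductivity.HubbardSuperconductivity.Theorems.KLRegimeSplit
open Summit.HubbardSuperconductivity.HubbardSuperconductivity.Theorems.KLProgrammeLegKernels

variable {L M : ℕ} [NeZero L]

/-- **`θ` in closed form**: `e·(4MA₀/β)·‖Ṽ‖_h/κ₀² = e·A₀·(4e⁴·kK + 16e⁸κ₀²·|U|)` for `β > 0` (`κ = ρ = κ₀ = √(2·6054)`). -/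
theorem theta_scaleZero_eq [NeZero M] {β : ℝ} (hβ : 0 < β) (U A₀ kK : ℝ) :
    Real.exp 1 * (4 * M * A₀ / β) *
        normV (GridLeg (GridPoint L (2 * (2 * M)))) (Real.sqrt (2 * (7 + 6047))) (Real.sqrt (2 * (7 + 6047)))
          ((fun m' : ℕ => if m' = 1 then |β| / (2 * (2 * M) : ℕ) * kK else if m' = 2 then |U| * |β| / (2 * (2 * M) : ℕ) else 0)) /
        Real.sqrt (2 * (7 + 6047)) ^ 2 =
      Real.exp 1 * A₀ * (4 * Real.exp 1 ^ 4 * kK + 16 * Real.exp 1 ^ 8 * Real.sqrt (2 * (7 + 6047)) ^ 2 * |U|) := by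
  haveI : NeZero (2 * (2 * M)) := ⟨by have := NeZero.ne M; omega⟩
  have hM : (0 : ℝ) < M := by exact_mod_cast Nat.pos_of_ne_zero (NeZero.ne M)
  have hκ : (0 : ℝ) < Real.sqrt (2 * (7 + 6047)) := Real.sqrt_pos.2 (by norm_num)
  have hκ2 : Real.sqrt (2 * (7 + 6047)) ^ 2 = 2 * (7 + 6047) := Real.sq_sqrt (by norm_num)
  rw [normV_scaleZeroPinnedL1_eq (four_le_card_gridLeg (L := L) (Ng := 2 * (2 * M))), abs_of_pos hβ]
  have he2 : Real.exp 2 = Real.exp 1 ^ 2 := by rw [← Real.exp_nat_mul]; norm_num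
  rw [he2]
  push_cast
  field_simp
  rw [hκ2]
  ring

/-- **`θ ≤ 1/2` from two regime conditions**: `16e⁵·A₀·kK ≤ 1` and `64e⁹κ₀²·A₀·|U| ≤ 1`. -/
theorem theta_scaleZero_le_half [NeZero M] {β : ℝ} (hβ : 0 < β) {U A₀ kK : ℝ}
    (hkK : 16 * Real.exp 1 ^ 5 * A₀ * kK ≤ 1) (hU : 64 * Real.exp 1 ^ 9 * Real.sqrt (2 * (7 + 6047)) ^ 2 * A₀ * |U| ≤ 1) :
    Real.exp 1 * (4 * M * A₀ / β) *
        normV (GridLeg (GridPoint L (2 * (2 * M)))) (Real.sqrt (2 * (7 + 6047))) (Real.sqrt (2 * (7 + 6047)))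
          ((fun m' : ℕ => if m' = 1 then |β| / (2 * (2 * M) : ℕ) * kK else if m' = 2 then |U| * |β| / (2 * (2 * M) : ℕ) else 0)) /
        Real.sqrt (2 * (7 + 6047)) ^ 2 ≤ 1 / 2 := by
  rw [theta_scaleZero_eq (L := L) hβ U A₀ kK]
  have h1 : Real.exp 1 * A₀ * (4 * Real.exp 1 ^ 4 * kK) ≤ 1 / 4 := by
    have : Real.exp 1 * A₀ * (4 * Real.exp 1 ^ 4 * kK) = (16 * Real.exp 1 ^ 5 * A₀ * kK) / 4 := by ring
    rw [this]; exact div_le_div_of_nonneg_right hkK (by norm_num)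
  have h2 : Real.exp 1 * A₀ * (16 * Real.exp 1 ^ 8 * Real.sqrt (2 * (7 + 6047)) ^ 2 * |U|) ≤ 1 / 4 := by
    have : Real.exp 1 * A₀ * (16 * Real.exp 1 ^ 8 * Real.sqrt (2 * (7 + 6047)) ^ 2 * |U|) =
        (64 * Real.exp 1 ^ 9 * Real.sqrt (2 * (7 + 6047)) ^ 2 * A₀ * |U|) / 4 := by ring
    rw [this]; exact div_le_div_of_nonneg_right hU (by norm_num)
  rw [mul_add]
  exact (add_le_add h1 h2).trans (by norm_num)

end Summit.HubbardSuperconductivity.HubbardSuperconductivity.Theorems.EngineV8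

end
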